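import Mathlib.Analysis.Complex.CauchyIntegral
import Mathlib.Analysis.Analytic.IsolatedZeros
import HarnessLib

/-!
# [AbsTopIII] §2–§4: Remarks 2.1.1, 2.5.1, 2.8.1, 2.8.3, 3.1.2, 3.1.3, 3.2.1, 3.2.2, 4.1.1, 4.1.2, 4.2.1

S. Mochizuki, *Topics in absolute anabelian geometry III: global reconstruction algorithms*
[MochizukiAbsTopIII2015]; locators `p.N` are the pages of the author's kurims manuscript (lit key
`paper:url-5493eb38cbb7`, 164 pp; the journal pagination is not held), each read on the page.
Wave-2 block W2-B14 of the abc-iut cell's L4 plan (L4-lead RULING π, 2026-08-25): the eleven Remarks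
of §2 "Archimedean Reconstruction Algorithms", §3 "Nonarchimedean Log-Frobenius Compatibility" and
§4 "Archimedean Log-Frobenius Compatibility" that belong neither to the statement files of seat
abc-iut-L4-t2 nor to the remark blocks W2-B1/B4/B5 (`FrobeniusPictureMLFRemarks`,
`ArchLogFrobeniusRemarks`, `RemarksArchimedean`).  Node ids `AbsTopIII:Rmk2.1.1` … `AbsTopIII:Rmk4.2.1`
of plan/L4/NODES.md.  Statements-first (D-0014): where a Remark makes an elementary mathematical
claim its kernel is TYPED AND PROVED below; definitions and named facts that seat L4-t2 has already
typed in its (staged or landed) statement files are CITED BY NAME, never re-declared; purely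
expository Remarks are RECORDED in this index by locator and thesis sentence only — no structure is
invented for them.  HONEST FRAMING: nothing here takes a side on [IUTchIII] Cor. 3.12; typed ≠
discharged.

## Index of the eleven Remarks

* **Rmk 2.1.1** p. 52 — (a) "there is a natural extension of the notions of Definition 2.1 to the
  case of Riemann orbisurfaces, which gives rise to 'Aut-holomorphic orbispaces'"; a Riemann
  orbisurface is "a one-dimensional complex analytic stack which is locally isomorphic to the …
  stack-theoretic quotient of a Riemann surface by a finite group of [holomorphic] automorphisms".
  TYPED by seat L4-t2 as `AutHolOrbispace` (presentations `[𝕌/Γ]`, `AutHolOrbispace.ofSpace`;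
  `Coorientations.lean`, staged) — cited, not re-declared.  (b) CLAIM "in particular, a Riemann
  orbisurface is necessarily a Riemann surface over the complement, in the coarse space associated to
  the orbisurface, of some discrete closed subset": its analytic kernel — the points fixed by a
  non-identity holomorphic self-map of a connected open `U ⊆ ℂ` (hence the points with non-trivial
  isotropy under a finite group of holomorphic automorphisms) form a discrete, relatively closed
  subset of `U` — is PROVED: `Rmk211.fixedPoints_isolated`, `Rmk211.fixedPoints_isolated_finset`,
  `Rmk211.isClosed_fixedLocus` (identity theorem, Mathlib
  `AnalyticOnNhd.eqOn_of_preconnected_of_frequently_eq`).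
* **Rmk 2.5.1** p. 57 — DEFINITION: "we shall refer to a frame of `U` at `p ∈ U` as orthogonal if
  it arises from an ordered pair of distinct intersecting sides of a rectangle `∈ ℛ(U) ⊆ 𝒫(U)`".
  TYPED by seat L4-t2 as `Parallelograms.IsOrthogonalFrame` (`HolomorphicCores.lean`, staged; the
  frames/sides/parallelograms of Prop 2.5 (a)–(d) are that file's `IsFrame`, `IsSide`,
  `parallelograms`) — cited, not re-declared.  No claim.
* **Rmk 2.8.1** p. 64 — CLAIM ("one verifies immediately"): "the isomorphism class of the pair
  `(1 → Δ_X → Π_X → G_k → 1, v)` depends only on the restriction of `v` to the subfield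
  `k^× ∪ {0} ⊆ k̄_NF^× ∪ {0}`".  TYPED by seat L4-t2 as the named schema
  `ArchimedeanReconstruction.IsomorphismClassDependsOnRestriction` over its `NFCurveData` shim of the
  π₁-interface (`ArchimedeanReconstruction.lean`, staged) — cited.  (Mathematical content: `G_k` acts
  transitively on the archimedean valuations of `k̄_NF` above a given one of `k`; not separately
  typed here — it needs the scheme side of the interface, seat L4-t1.)
* **Rmk 2.8.3** p. 64 — CLAIM ("one verifies immediately"): "any elliptically admissible hyperbolic
  orbicurve defined over a number field is of strictly Belyi type"; hence Cor 2.7 applies to the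
  Aut-holomorphic orbispaces of Cor 2.8; the rest is methodological (why Cor 2.7 (c) builds the
  local additive structures directly rather than via the parallelograms of Prop 2.5/2.6).  TYPED by
  seat L4-t2 as the schema `ArchimedeanReconstruction.EllipticallyAdmissibleOverNFIsStrictlyBelyi`
  over the predicates `IsEllipticallyAdmissible` / `IsStrictlyBelyiType` (owners L4-t4 / L4-t1) —
  cited.  FACT-policy (Belyi maps), never discharged under campaign M.
* **Rmk 3.1.2** p. 70 — RECORDED (expository): "by definition, the algorithms of Corollary 1.10
  form an essential portion of each object of the category `Anab`.  … the 'software' constituted by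
  these algorithms is not just executed once, leaving behind some 'output data' …, but rather
  executed over and over again within each object of `Anab`."  No mathematical claim.
* **Rmk 3.1.3** p. 71 — RECORDED (variant left to the reader): "one natural variant of the notion of
  an 'MLF-Galois `T`-pair of hyperbolic orbicurve type' is the notion of an 'MLF-Galois `T`-pair of
  tempered hyperbolic orbicurve type', i.e., the case where `Π_k ↠ G_k` arises from the tempered
  fundamental group of a hyperbolic orbicurve over `k` [cf. Remarks 1.9.1, 1.10.2].  We leave to the
  reader the routine details of developing the resulting tempered version of the theory".  No
  statement is printed; the hypothesis predicate would be supplied by the tempered-π₁ interface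
  (seat abc-iut-L3-t2), exactly as `IsOfHypOrbicurveType` enters L4-t2's `AutPairCenterFree`.
* **Rmk 3.2.1** p. 73 — CLAIM/CONSTRUCTION: "the algorithm applied to construct the natural
  isomorphism of Corollary 1.10, (a), is essentially the same as the algorithm of Proposition 3.2,
  (i).  In particular, this algorithm does not require that `(Π ↷ M_T)` be of hyperbolic orbicurve
  type.  Thus, by imposing the condition of 'compatibility with the natural isomorphism of Corollary
  1.10, (a)', we thus obtain … a functorial algorithm for constructing the natural isomorphism
  `μ_Ẑ(M_TM) ⥲ μ_Ẑ(G)`".  TYPED by seat L4-t2 as the output field `MonoidKummerTheory.cycIso`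
  (`MonoidKummerMaps.lean`, staged; `μ_Ẑ(M)` = L4-t2's `cyclotome`, `μ_Ẑ(G)` = L4-t1's cyclotome of
  Cor 1.10 (a)) — cited.  FACT-policy content (LCFT), never discharged under campaign M.
* **Rmk 3.2.2** p. 73 — RECORDED (convention): "the functoriality of Proposition 3.2, (i), when
  applied to the isomorphism `H²(G, μ_Ẑ(M_TM)) ⥲ Ẑ`, is to be understood in the sense of a
  'compatibility', relative to dividing the 'Ẑ' that appears as the codomain of these isomorphisms by
  a factor given by the index of the image of the induced open homomorphism on arithmetic Galois
  groups [cf. Definition 3.1, (ii)].  A similar remark [cf. Remark 1.10.1, (i)] applies to the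
  cyclotome 'μ_Ẑ(Π)' that appears in Proposition 3.2, (ii).  We leave the routine details to the
  reader."  (Classical form: for an open subgroup `G' ⊆ G` of index `n`, restriction on `H²(−, μ)`
  corresponds to multiplication by `n` on invariants — local class field theory, FOUNDATIONS row 15;
  no cohomology of profinite groups in Mathlib, so nothing is typed beyond L4-t2's
  `ContCohomologyData` interface.)  Second paragraph (p. 73, added per referee abc-iut-ref-f F16):
  "In a similar vein, one may consider Kummer maps for '`𝒪^×`' [as opposed to '`𝒪^⊳`'], in which
  case the natural isomorphism of Remark 3.2.1 is only determined up to a `Ẑ^×`-multiple [cf.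
  [Mzk17], Remark 2.4.2]" — this is the `Ẑ^×`-indeterminacy typed by L4-t2 as the torsor field
  `UnitKummerTheory.cycIsoClass` of Prop 3.3 (i) (`MonoidKummerMaps.lean`).
* **Rmk 4.1.1** p. 105 — RECORDED (cross-reference): "the topological monoid '`𝒪^⊳_k`' associated
  to a CAF `k` [cf. Definition 4.1, (i)] is essentially the data used to construct the archimedean
  Frobenioids of [Mzk17], Example 3.3, (ii)."  In the tree: `𝒪^⊳_k = {x ∈ k^× | ‖x‖ ≤ 1}` is L4-t2's
  `archNonzeroIntegers` (`ArchimedeanLogFrobenius.lean`, staged); its polar decomposition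
  `𝒪^⊳_ℂ ≅ S¹ × ℝ_{≥0}` is PROVED in `AbsTopIII/RemarksLogShells.lean` (`Rmk_5_10_2_iii_polar`,
  seat L4-t16); [Mzk17] = [FrdII] Example 3.3 is layer L1's `Literature/AlgebraicGeometry/Frobenioids`
  (seat abc-iut-L1-t6, archimedean Frobenioids).  No new claim.
* **Rmk 4.1.2** p. 105 — RECORDED (scope): the requirements that "the structure-orbispace always be
  elliptically admissible, and that the base field always be a CAF" are simplifying; "many aspects of
  the theory of the present §4 may be generalized to accommodate 'structure-orbispaces' that are
  Aut-holomorphic orbispaces that arise from more general hyperbolic orbicurves … over arbitrary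
  archimedean fields [i.e., either CAF's or RAF's]", but "such generalizations … are beyond the scope
  of the present paper."  No claim.
* **Rmk 4.2.1** p. 106 — RECORDED (negative claim, "as is easily verified", no proof printed):
  "unlike the case with Proposition 3.2, (iv), the id-rigidity portion of Proposition 4.2, (i), is
  false for the '𝒞̲' and '𝒞̲̲' versions of `𝒞^hol_T`, `𝒞^{hol-sB}_T`" (the subcategories of
  `T`-isomorphisms, resp. of structure-isomorphisms, in the three-way notation of Def 4.1 (iii)
  p. 103 "𝒞̲ (respectively, 𝒞̲̲; 𝒞̲̲̲) … the subcategories determined by the `T`-isomorphisms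
  (respectively, structure-isomorphisms; isomorphisms)" — Prop 4.2 (i) asserts id-rigidity for the
  isomorphism version `𝒞 = 𝒞̲̲̲`; id-rigid = every automorphism of the identity functor is the
  identity, §0 p. 27; gloss corrected per referee abc-iut-ref-l L1-F2).  Not typed: the
  categories `𝒞^hol_T` are not yet assembled as Mathlib `Category` instances (L4-t2 types the
  objects/morphisms `AutHolPair`, `AutHolPair.Hom`, `.IsTIso`), and the text does not name the
  non-trivial automorphism of the identity functor it has in mind; recorded for the eventual
  category file.

Deliberately NOT here: Def 2.1–Cor 2.9, Def 3.1–Prop 3.3, Def 4.1–Lem 4.4 and their named facts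
(seat L4-t2), Rmk 3.1.1 (re-typed by L4-t2 in `MonoidKummerMaps`; its MLF-level form is PROVED in
`MLFUnitsInfinitelyDivisible.lean`), the other remark blocks (B1/B4/B5/B8).
-/

namespace Literature.AnabelianGeometry.AbsoluteAnabelian.AbsTopIII

open _root_.Filter _root_.Topology Set

/-! ### Remark 2.1.1 (b), p. 52 — the non-free locus of a finite group of holomorphic automorphisms
is discrete and closed -/

namespace Rmk211

/-- **Rmk 2.1.1, analytic kernel.**  A holomorphic self-map `g` of a connected open `U ⊆ ℂ` that is
not the identity on `U` has ISOLATED fixed points in `U`: near every `z₀ ∈ U`, `g w ≠ w` for all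
`w ≠ z₀` close to `z₀` (identity theorem applied to `g` and `id`).  This is why the points of a
Riemann orbisurface with non-trivial isotropy — locally the fixed points of finitely many
non-identity holomorphic automorphisms of a Riemann surface — form "some discrete closed subset" of
the coarse space.
[cite: MochizukiAbsTopIII2015, Remark 2.1.1 p.52] -/
theorem fixedPoints_isolated {U : Set ℂ} (hU : IsOpen U) (hU' : IsPreconnected U) {g : ℂ → ℂ}
    (hg : DifferentiableOn ℂ g U) (hne : ∃ z ∈ U, g z ≠ z) {z₀ : ℂ} (hz₀ : z₀ ∈ U) :
    ∀ᶠ w in 𝓝[≠] z₀, g w ≠ w := by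
  by_contra h
  have hfreq : ∃ᶠ w in 𝓝[≠] z₀, g w = id w := by
    simpa [Filter.not_eventually] using h
  have heq : EqOn g id U :=
    (hg.analyticOnNhd hU).eqOn_of_preconnected_of_frequently_eq analyticOnNhd_id hU' hz₀ hfreq
  obtain ⟨z, hz, hgz⟩ := hne
  exact hgz (heq hz)

/-- **Rmk 2.1.1, analytic kernel (finite group version).**  For a finite family of holomorphic
self-maps of a connected open `U ⊆ ℂ`, none of which is the identity on `U`, the points of `U` moved
by every member form a punctured neighbourhood of each point of `U`: the locus of points with
non-trivial isotropy is discrete in `U`.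
[cite: MochizukiAbsTopIII2015, Remark 2.1.1 p.52] -/
theorem fixedPoints_isolated_finset {U : Set ℂ} (hU : IsOpen U) (hU' : IsPreconnected U)
    {ι : Type*} (S : Finset ι) (g : ι → ℂ → ℂ) (hg : ∀ i ∈ S, DifferentiableOn ℂ (g i) U)
    (hne : ∀ i ∈ S, ∃ z ∈ U, g i z ≠ z) {z₀ : ℂ} (hz₀ : z₀ ∈ U) :
    ∀ᶠ w in 𝓝[≠] z₀, ∀ i ∈ S, g i w ≠ w := by
  rw [Finset.eventually_all]
  intro i hi
  exact fixedPoints_isolated hU hU' (hg i hi) (hne i hi) hz₀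

/-- **Rmk 2.1.1, analytic kernel (closedness).**  The fixed locus of a continuous self-map of `U` is
closed in `U` (for the subspace topology) — together with `fixedPoints_isolated`: "some discrete
closed subset".
[cite: MochizukiAbsTopIII2015, Remark 2.1.1 p.52] -/
theorem isClosed_fixedLocus {U : Set ℂ} {g : ℂ → ℂ} (hg : ContinuousOn g U) :
    IsClosed ((Subtype.val : U → ℂ) ⁻¹' {w | g w = w}) := by
  have h1 : Continuous fun u : U => g u := hg.restrict
  have h2 : Continuous fun u : U => (u : ℂ) := continuous_subtype_val
  simpa [Set.preimage] using isClosed_eq h1 h2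

end Rmk211

end Literature.AnabelianGeometry.AbsoluteAnabelian.AbsTopIII
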